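import Mathlib

/-!
# Five-letter deficiency bound for ordered escape ladders (support file)

Item `stmt-MatrixMultiplication-14308` (`FourierTwoFamiliesModP.PrimeTwoFamilies`, CKSU 2005
Conj. 4.7 with prime cyclic hosts), line `Sketch`, ladder / capacity language
(`LadderLift.primeTwoFamilies_iff_cyclicLadder`, `CapacityLift.codeLift`).

An ORDERED ESCAPE LADDER in a finite abelian group `G` is a family of `r` classes `(X c, Y c)`,
`c : Fin r`, of DIRECT pairs (hypothesis `hW`: `(x - x') + (y - y') = 0 → x = x' ∧ y = y'`) such
that for classes `p < q` every upper cross difference `y' - x'` (`x' ∈ X p`, `y' ∈ Y q`) differs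
from every diagonal difference `y - x` (`x ∈ X c`, `y ∈ Y c`, any class `c`) — hypothesis `hL`.
Write `N = |G|`, let `V` be a lower bound for the co-volumes `|X c| * |Y c|`, and `k = N - V` the
DEFICIENCY.

THE BOUND (`ladder_pow_three_le_pow_five`): as soon as the ladder has FIVE classes
`c₀ < c₁ < c₂ < c₃ < c₄`,
$$ V ^ 3 \le (N - V) ^ 5 . $$
So five-letter ladders have deficiency `k ≥ V^{3/5} ≈ N^{3/5}`, whereas three- and four-letter
ladders exist with deficiency `O(√N)` in every cyclic group (explicit: `({0}, ·)`, `([1,a], (a+1)·[0,b))`,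
`(-a-(a+1)·[1,b], ·+[0,a))`, `(·, {c})`; lead c2 census notes) and the radix designs of CKSU
Prop. 4.5 give `2^d` letters at deficiency `≈ d·N^{1-1/d}`.  This is the first rung above the
packing bound `r √V ≤ N` (`ladder_card_mul_sqrt_le`) that separates alphabet sizes, and it is what a
finite census at high co-volume sees (no fifth letter near co-volume `N - O(√N)`).

PROOF.  Every cross-difference set `Y q - X p` (`p < q`) is disjoint from the diagonal difference
set `Y c₂ - X c₂`, which has exactly `|X c₂| |Y c₂| ≥ V` elements by directness
(`card_sub_eq_card_mul_card_of_direct`), so `|Y q - X p| ≤ k` (`card_cross_sub_le`); in particular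
`|Y c₁| ≤ |Y c₁ - X c₀| ≤ k` and `|X c₃| ≤ |Y c₄ - X c₃| ≤ k`, whence `|X c₁| ≥ V / k` and
`|Y c₃| ≥ V / k`.  Two applications of Ruzsa's triangle inequality
(`Finset.ruzsa_triangle_inequality_sub_sub_sub`),
`|Y c₂ - Y c₃| · |X c₁| ≤ |Y c₂ - X c₁| · |Y c₃ - X c₁| ≤ k²` and
`|Y c₂ - X c₂| · |Y c₃| ≤ |Y c₂ - Y c₃| · |X c₂ - Y c₃| ≤ |Y c₂ - Y c₃| · k`,
give `V · |Y c₃| · |X c₁| ≤ |Y c₂ - X c₂| · |Y c₃| · |X c₁| ≤ k³`, i.e. `V³ ≤ k⁵`.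
-/

-- single-conjunct summit: the mandated namespace repeats `MatrixMultiplication` (summit = sub-problem).
set_option linter.dupNamespace false

namespace Summit.MatrixMultiplication.MatrixMultiplication.Theorems.PrimeTwoFamilies.LadderLift

open Finset
open scoped Pointwise

variable {G : Type*} [AddCommGroup G] [DecidableEq G]

/-- A DIRECT pair `(X, Y)` (`(x - x') + (y - y') = 0 → x = x' ∧ y = y'`) has a full difference set:
`|Y - X| = |Y| * |X|`, because `(y, x) ↦ y - x` is injective on `Y × X`. -/
theorem card_sub_eq_card_mul_card_of_direct (X Y : Finset G)
    (hW : ∀ x ∈ X, ∀ x' ∈ X, ∀ y ∈ Y, ∀ y' ∈ Y, (x - x') + (y - y') = 0 → x = x' ∧ y = y') :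
    (Y - X).card = Y.card * X.card := by
  change (image₂ (· - ·) Y X).card = Y.card * X.card
  refine card_image₂_iff.2 ?_
  rintro ⟨y, x⟩ hyx ⟨y', x'⟩ hyx' h
  simp only [Set.mem_prod, mem_coe] at hyx hyx'
  dsimp only at h
  have h0 : (x' - x) + (y - y') = 0 := by
    have h1 : y - x - (y' - x') = 0 := sub_eq_zero.2 h
    rw [← h1]; abel
  obtain ⟨hx, hy⟩ := hW x' hyx'.2 x hyx.2 y hyx.1 y' hyx'.1 h0
  rw [hx, hy]

variable [Fintype G]

/-- In an ordered escape ladder, an upper cross-difference set `Y q - X p` (`p < q`) is disjoint from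
every diagonal difference set `Y c - X c`; if the class `c` is direct the latter has `|X c| * |Y c|`
elements, so `|Y q - X p| + |X c| * |Y c| ≤ |G|`. -/
theorem card_cross_sub_add_le {r : ℕ} (X Y : Fin r → Finset G)
    (hL : ∀ c p q : Fin r, p < q → ∀ x ∈ X c, ∀ y ∈ Y c, ∀ x' ∈ X p, ∀ y' ∈ Y q, y - x ≠ y' - x')
    {p q : Fin r} (hpq : p < q) (c : Fin r)
    (hWc : ∀ x ∈ X c, ∀ x' ∈ X c, ∀ y ∈ Y c, ∀ y' ∈ Y c, (x - x') + (y - y') = 0 → x = x' ∧ y = y') :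
    (Y q - X p).card + (X c).card * (Y c).card ≤ Fintype.card G := by
  have hdisj : Disjoint (Y q - X p) (Y c - X c) := by
    rw [Finset.disjoint_left]
    intro d hd hd'
    rw [mem_sub] at hd hd'
    obtain ⟨y', hy', x', hx', rfl⟩ := hd
    obtain ⟨y, hy, x, hx, he⟩ := hd'
    exact hL c p q hpq x hx y hy x' hx' y' hy' he
  calc (Y q - X p).card + (X c).card * (Y c).card
      = ((Y q - X p) ∪ (Y c - X c)).card := by
        rw [card_union_of_disjoint hdisj, card_sub_eq_card_mul_card_of_direct (X c) (Y c) hWc,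
          mul_comm]
    _ ≤ Fintype.card G := card_le_univ _

/-- **Five-letter deficiency bound.**  In an ordered escape ladder of direct classes in a finite
abelian group `G`, if five classes `c₀ < c₁ < c₂ < c₃ < c₄` are available and every class has
co-volume `|X c| * |Y c| ≥ V`, then `V ^ 3 ≤ (|G| - V) ^ 5`. -/
theorem ladder_pow_three_le_pow_five {r : ℕ} (X Y : Fin r → Finset G)
    (hW : ∀ c : Fin r, ∀ x ∈ X c, ∀ x' ∈ X c, ∀ y ∈ Y c, ∀ y' ∈ Y c,
      (x - x') + (y - y') = 0 → x = x' ∧ y = y')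
    (hL : ∀ c p q : Fin r, p < q → ∀ x ∈ X c, ∀ y ∈ Y c, ∀ x' ∈ X p, ∀ y' ∈ Y q, y - x ≠ y' - x')
    (c₀ c₁ c₂ c₃ c₄ : Fin r) (h₀₁ : c₀ < c₁) (h₁₂ : c₁ < c₂) (h₂₃ : c₂ < c₃) (h₃₄ : c₃ < c₄)
    (V : ℕ) (hV : ∀ c : Fin r, V ≤ (X c).card * (Y c).card) :
    V ^ 3 ≤ (Fintype.card G - V) ^ 5 := by
  rcases Nat.eq_zero_or_pos V with rfl | hVpos
  · simp
  set k : ℕ := Fintype.card G - V with hk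
  -- every class is non-empty on both sides
  have hne : ∀ c, (X c).Nonempty ∧ (Y c).Nonempty := by
    intro c
    have h : 0 < (X c).card * (Y c).card := hVpos.trans_le (hV c)
    refine ⟨card_ne_zero.1 fun h0 => ?_, card_ne_zero.1 fun h0 => ?_⟩
    · rw [h0, zero_mul] at h; exact lt_irrefl 0 h
    · rw [h0, mul_zero] at h; exact lt_irrefl 0 h
  -- every upper cross-difference set has at most `k` elements
  have hcross : ∀ p q : Fin r, p < q → (Y q - X p).card ≤ k := by
    intro p q hpq
    have h := card_cross_sub_add_le X Y hL hpq c₂ (hW c₂)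
    have h2 := hV c₂
    omega
  have hY1 : (Y c₁).card ≤ k := (card_le_card_sub_right (hne c₀).1).trans (hcross c₀ c₁ h₀₁)
  have hX3 : (X c₃).card ≤ k := (card_le_card_sub_left (hne c₄).2).trans (hcross c₃ c₄ h₃₄)
  have h12 : (Y c₂ - X c₁).card ≤ k := hcross _ _ h₁₂
  have h13 : (Y c₃ - X c₁).card ≤ k := hcross _ _ (h₁₂.trans h₂₃)
  have h23 : (Y c₃ - X c₂).card ≤ k := hcross _ _ h₂₃
  -- Ruzsa's triangle inequality, twice
  have hR1 := ruzsa_triangle_inequality_sub_sub_sub (Y c₂) (X c₁) (Y c₃)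
  have hR2 := ruzsa_triangle_inequality_sub_sub_sub (Y c₂) (Y c₃) (X c₂)
  have hneg : (X c₂ - Y c₃).card = (Y c₃ - X c₂).card := by
    rw [← neg_sub (Y c₃) (X c₂), card_neg]
  have hdir : (Y c₂ - X c₂).card = (Y c₂).card * (X c₂).card :=
    card_sub_eq_card_mul_card_of_direct _ _ (hW c₂)
  rw [hneg] at hR2
  -- numeric assembly
  have hA : (Y c₂ - Y c₃).card * (X c₁).card ≤ k * k := hR1.trans (Nat.mul_le_mul h12 h13)
  have hB : (Y c₂ - X c₂).card * (Y c₃).card ≤ (Y c₂ - Y c₃).card * k :=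
    hR2.trans (Nat.mul_le_mul_left _ h23)
  have hC : (Y c₂ - X c₂).card * (Y c₃).card * (X c₁).card ≤ k * k * k :=
    calc (Y c₂ - X c₂).card * (Y c₃).card * (X c₁).card
        ≤ (Y c₂ - Y c₃).card * k * (X c₁).card := Nat.mul_le_mul_right _ hB
      _ = (Y c₂ - Y c₃).card * (X c₁).card * k := by ring
      _ ≤ k * k * k := Nat.mul_le_mul_right _ hA
  have hVa : V ≤ (X c₁).card * k := (hV c₁).trans (Nat.mul_le_mul_left _ hY1)
  have hVb : V ≤ k * (Y c₃).card := (hV c₃).trans (Nat.mul_le_mul_right _ hX3)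
  have hVc : V ≤ (Y c₂ - X c₂).card := by rw [hdir, mul_comm]; exact hV c₂
  calc V ^ 3 = V * V * V := by ring
    _ ≤ (Y c₂ - X c₂).card * (k * (Y c₃).card) * ((X c₁).card * k) :=
        Nat.mul_le_mul (Nat.mul_le_mul hVc hVb) hVa
    _ = ((Y c₂ - X c₂).card * (Y c₃).card * (X c₁).card) * (k * k) := by ring
    _ ≤ (k * k * k) * (k * k) := Nat.mul_le_mul_right _ hC
    _ = k ^ 5 := by ring

/-- **Five-letter deficiency bound**, `Fin r` form: an ordered escape ladder of `r ≥ 5` direct classes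
with all co-volumes `≥ V` in a finite abelian group `G` satisfies `V ^ 3 ≤ (|G| - V) ^ 5`. -/
theorem ladder_pow_three_le_pow_five_of_five_le {r : ℕ} (hr : 5 ≤ r) (X Y : Fin r → Finset G)
    (hW : ∀ c : Fin r, ∀ x ∈ X c, ∀ x' ∈ X c, ∀ y ∈ Y c, ∀ y' ∈ Y c,
      (x - x') + (y - y') = 0 → x = x' ∧ y = y')
    (hL : ∀ c p q : Fin r, p < q → ∀ x ∈ X c, ∀ y ∈ Y c, ∀ x' ∈ X p, ∀ y' ∈ Y q, y - x ≠ y' - x')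
    (V : ℕ) (hV : ∀ c : Fin r, V ≤ (X c).card * (Y c).card) :
    V ^ 3 ≤ (Fintype.card G - V) ^ 5 :=
  ladder_pow_three_le_pow_five X Y hW hL ⟨0, by omega⟩ ⟨1, by omega⟩ ⟨2, by omega⟩ ⟨3, by omega⟩
    ⟨4, by omega⟩ (Fin.mk_lt_mk.2 (by norm_num)) (Fin.mk_lt_mk.2 (by norm_num))
    (Fin.mk_lt_mk.2 (by norm_num)) (Fin.mk_lt_mk.2 (by norm_num)) V hV

/-- **Five-letter deficiency bound in `ZMod m`** (the host of the cyclic ladder conjecture): an ordered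
escape ladder of `r ≥ 5` direct classes in `ZMod m` with all co-volumes `≥ V` has `V ^ 3 ≤ (m - V) ^ 5`. -/
theorem ladder_zmod_pow_three_le_pow_five_of_five_le {m : ℕ} [NeZero m] {r : ℕ} (hr : 5 ≤ r)
    (X Y : Fin r → Finset (ZMod m))
    (hW : ∀ c : Fin r, ∀ x ∈ X c, ∀ x' ∈ X c, ∀ y ∈ Y c, ∀ y' ∈ Y c,
      (x - x') + (y - y') = 0 → x = x' ∧ y = y')
    (hL : ∀ c p q : Fin r, p < q → ∀ x ∈ X c, ∀ y ∈ Y c, ∀ x' ∈ X p, ∀ y' ∈ Y q, y - x ≠ y' - x')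
    (V : ℕ) (hV : ∀ c : Fin r, V ≤ (X c).card * (Y c).card) :
    V ^ 3 ≤ (m - V) ^ 5 := by
  have h := ladder_pow_three_le_pow_five_of_five_le hr X Y hW hL V hV
  rwa [ZMod.card] at h

end Summit.MatrixMultiplication.MatrixMultiplication.Theorems.PrimeTwoFamilies.LadderLift

namespace Summit.MatrixMultiplication.MatrixMultiplication.Theorems.PrimeTwoFamilies.LadderLift

open Finset
open scoped Pointwise

/-! ## The hub inequality (appended, lead c2)

For a class `j` of an ordered escape ladder write `W j = ⋃_{σ < j} X σ` (the LEFT HUB) and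
`U j = ⋃_{j < τ} Y τ` (the RIGHT HUB).  The three sets `U j - X j`, `Y j - W j`, `U j - W j` consist of
upper cross differences, so each is disjoint from the diagonal difference set `Y j - X j`, which has
`|X j| |Y j|` elements when the class `j` is direct.  Two applications of Ruzsa's triangle inequality
(`|Y j - X j| |U j| ≤ |Y j - U j| |X j - U j|` and `|Y j - U j| |W j| ≤ |Y j - W j| |U j - W j|`) give
the HUB INEQUALITY
$$ |X j|\,|Y j| \cdot |W j| \cdot |U j| \le (|G| - |X j|\,|Y j|)^3 , $$
which contains the five-letter bound (`|W 2| ≥ |X 1| ≥ V/k`, `|U 2| ≥ |Y 3| ≥ V/k`) and, for a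
ladder with balanced classes `|X c| = |Y c| = s`, reads `j (r-1-j) s^4 ≤ (|G| - s^2)^3`, i.e.
`(r-1) · s² ≤ 2 (|G| - s²)^{3/2}` at the median class — at co-volume `|G| - k` at most
`O(k^{3/2} / |G|)` classes, against `O(|G|^{1/2})` from packing alone. -/

/-- A finset disjoint from another finset inside a finite type: the sizes add up to at most the
cardinality of the type. -/
private lemma card_add_card_le_of_disjoint {G : Type*} [DecidableEq G] [Fintype G]
    (S E : Finset G) (h : Disjoint S E) :
    S.card + E.card ≤ Fintype.card G := by
  rw [← card_union_of_disjoint h]; exact card_le_univ _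

/-- **Hub inequality for ordered escape ladders.**  For every class `j` whose pair `(X j, Y j)` is
direct, `|X j| |Y j| · |⋃_{σ<j} X σ| · |⋃_{j<τ} Y τ| ≤ (|G| - |X j| |Y j|) ^ 3`. -/
theorem ladder_hub_le {G : Type*} [AddCommGroup G] [DecidableEq G] [Fintype G] {r : ℕ}
    (X Y : Fin r → Finset G)
    (hL : ∀ c p q : Fin r, p < q → ∀ x ∈ X c, ∀ y ∈ Y c, ∀ x' ∈ X p, ∀ y' ∈ Y q, y - x ≠ y' - x')
    (j : Fin r)
    (hWj : ∀ x ∈ X j, ∀ x' ∈ X j, ∀ y ∈ Y j, ∀ y' ∈ Y j, (x - x') + (y - y') = 0 → x = x' ∧ y = y') :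
    (X j).card * (Y j).card * ((Finset.univ.filter (· < j)).biUnion X).card *
        ((Finset.univ.filter (j < ·)).biUnion Y).card ≤
      (Fintype.card G - (X j).card * (Y j).card) ^ 3 := by
  set W : Finset G := (Finset.univ.filter (· < j)).biUnion X with hWdef
  set U : Finset G := (Finset.univ.filter (j < ·)).biUnion Y with hUdef
  set k : ℕ := Fintype.card G - (X j).card * (Y j).card with hk
  have hdiag : (Y j - X j).card = (Y j).card * (X j).card :=
    card_sub_eq_card_mul_card_of_direct _ _ hWj
  -- membership in the hubs
  have hmemW : ∀ x' ∈ W, ∃ σ, σ < j ∧ x' ∈ X σ := by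
    intro x' hx'
    rw [hWdef, mem_biUnion] at hx'
    obtain ⟨σ, hσ, hx⟩ := hx'
    exact ⟨σ, (mem_filter.1 hσ).2, hx⟩
  have hmemU : ∀ y' ∈ U, ∃ τ, j < τ ∧ y' ∈ Y τ := by
    intro y' hy'
    rw [hUdef, mem_biUnion] at hy'
    obtain ⟨τ, hτ, hy⟩ := hy'
    exact ⟨τ, (mem_filter.1 hτ).2, hy⟩
  -- the three cross sets avoid the diagonal set of class `j`
  have hdisj : ∀ (A B : Finset G), (∀ y' ∈ A, ∀ x' ∈ B, ∃ p q, p < q ∧ x' ∈ X p ∧ y' ∈ Y q) →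
      Disjoint (A - B) (Y j - X j) := by
    intro A B hAB
    rw [Finset.disjoint_left]
    intro d hd hd'
    rw [mem_sub] at hd hd'
    obtain ⟨y', hy', x', hx', rfl⟩ := hd
    obtain ⟨y, hy, x, hx, he⟩ := hd'
    obtain ⟨p, q, hpq, hxp, hyq⟩ := hAB y' hy' x' hx'
    exact hL j p q hpq x hx y hy x' hxp y' hyq he
  have hbound : ∀ (A B : Finset G), (∀ y' ∈ A, ∀ x' ∈ B, ∃ p q, p < q ∧ x' ∈ X p ∧ y' ∈ Y q) →
      (A - B).card ≤ k := by
    intro A B hAB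
    have h := card_add_card_le_of_disjoint _ _ (hdisj A B hAB)
    rw [hdiag] at h
    rw [hk, mul_comm]
    omega
  have hUX : (U - X j).card ≤ k :=
    hbound U (X j) fun y' hy' x' hx' => by
      obtain ⟨τ, hτ, hy⟩ := hmemU y' hy'
      exact ⟨j, τ, hτ, hx', hy⟩
  have hYW : (Y j - W).card ≤ k :=
    hbound (Y j) W fun y' hy' x' hx' => by
      obtain ⟨σ, hσ, hx⟩ := hmemW x' hx'
      exact ⟨σ, j, hσ, hx, hy'⟩
  have hUW : (U - W).card ≤ k :=
    hbound U W fun y' hy' x' hx' => by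
      obtain ⟨τ, hτ, hy⟩ := hmemU y' hy'
      obtain ⟨σ, hσ, hx⟩ := hmemW x' hx'
      exact ⟨σ, τ, hσ.trans hτ, hx, hy⟩
  -- Ruzsa's triangle inequality, twice
  have hR1 := ruzsa_triangle_inequality_sub_sub_sub (Y j) U (X j)
  have hR2 := ruzsa_triangle_inequality_sub_sub_sub (Y j) W U
  have hneg : (X j - U).card = (U - X j).card := by rw [← neg_sub U (X j), card_neg]
  rw [hneg] at hR1
  have hA : (Y j - X j).card * U.card ≤ (Y j - U).card * k := hR1.trans (Nat.mul_le_mul_left _ hUX)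
  have hB : (Y j - U).card * W.card ≤ k * k := hR2.trans (Nat.mul_le_mul hYW hUW)
  calc (X j).card * (Y j).card * W.card * U.card
      = ((Y j - X j).card * U.card) * W.card := by rw [hdiag]; ring
    _ ≤ ((Y j - U).card * k) * W.card := Nat.mul_le_mul_right _ hA
    _ = ((Y j - U).card * W.card) * k := by ring
    _ ≤ (k * k) * k := Nat.mul_le_mul_right _ hB
    _ = k ^ 3 := by ring

/-! ## The three-letter bound (appended, lead c2)

The first rung of the deficiency ladder, for the record: a class strictly between two others has
both sides inside cross-difference sets, so `V ≤ |X c₁| |Y c₁| ≤ (|G| - V)^2` — three-letter ladders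
have deficiency at least `√V`, and the explicit three- and four-letter ladders (`exists_ladder_four_zmod`)
show that `Θ(√|G|)` is the truth for three and four classes. -/

/-- **Three-letter deficiency bound.**  In an ordered escape ladder of direct classes with co-volumes
`≥ V`, three classes `c₀ < c₁ < c₂` force `V ≤ (|G| - V) ^ 2`. -/
theorem ladder_le_pow_two {G : Type*} [AddCommGroup G] [DecidableEq G] [Fintype G] {r : ℕ}
    (X Y : Fin r → Finset G)
    (hW : ∀ c : Fin r, ∀ x ∈ X c, ∀ x' ∈ X c, ∀ y ∈ Y c, ∀ y' ∈ Y c,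
      (x - x') + (y - y') = 0 → x = x' ∧ y = y')
    (hL : ∀ c p q : Fin r, p < q → ∀ x ∈ X c, ∀ y ∈ Y c, ∀ x' ∈ X p, ∀ y' ∈ Y q, y - x ≠ y' - x')
    (c₀ c₁ c₂ : Fin r) (h₀₁ : c₀ < c₁) (h₁₂ : c₁ < c₂)
    (V : ℕ) (hV : ∀ c : Fin r, V ≤ (X c).card * (Y c).card) :
    V ≤ (Fintype.card G - V) ^ 2 := by
  rcases Nat.eq_zero_or_pos V with rfl | hVpos
  · simp
  set k : ℕ := Fintype.card G - V with hk
  have hne : ∀ c, (X c).Nonempty ∧ (Y c).Nonempty := by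
    intro c
    have h : 0 < (X c).card * (Y c).card := hVpos.trans_le (hV c)
    refine ⟨card_ne_zero.1 fun h0 => ?_, card_ne_zero.1 fun h0 => ?_⟩
    · rw [h0, zero_mul] at h; exact lt_irrefl 0 h
    · rw [h0, mul_zero] at h; exact lt_irrefl 0 h
  have hcross : ∀ p q : Fin r, p < q → (Y q - X p).card ≤ k := by
    intro p q hpq
    have h := card_cross_sub_add_le X Y hL hpq c₁ (hW c₁)
    have h2 := hV c₁
    omega
  have hY1 : (Y c₁).card ≤ k := (card_le_card_sub_right (hne c₀).1).trans (hcross c₀ c₁ h₀₁)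
  have hX1 : (X c₁).card ≤ k := (card_le_card_sub_left (hne c₂).2).trans (hcross c₁ c₂ h₁₂)
  calc V ≤ (X c₁).card * (Y c₁).card := hV c₁
    _ ≤ k * k := Nat.mul_le_mul hX1 hY1
    _ = k ^ 2 := by ring

/-! ## The sharp middle-class bound (appended, lead c2)

Sharper than `ladder_le_pow_two` and tight up to `O(1)`: for a direct class `c₁` strictly between a
class `c₀` (with some `p₀ ∈ X c₀`) and a class `c₂` (with some `q₂ ∈ Y c₂`), the two cross sets
`Y c₁ - p₀` and `q₂ - X c₁` avoid the diagonal set `Y c₁ - X c₁` and meet in at most ONE point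
(two common points `y - p₀ = q₂ - x`, `y' - p₀ = q₂ - x'` give `(x - x') + (y - y') = 0`), whence
$$ |X c₁|\,|Y c₁| + |X c₁| + |Y c₁| \le |G| + 1 . $$
So a three-letter ladder of min co-volume `V` needs `V + 2√V ≤ |G| + 1`, i.e. `V ≤ (√(|G|+2) - 1)^2`:
the torus product alphabet of CKSU (`(M-1)^2` in `ℤ/M × ℤ/M`) and the explicit cyclic three-letter
ladders (`ab` whenever `ab + a + b ≲ M`) are optimal up to an additive constant, and NO four-letter
ladder can beat the two-digit torus hull value `(√m - 1)^2` (finite-census calibration). -/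

/-- **Sharp middle-class bound for ordered escape ladders.**  If `c₀ < c₁ < c₂`, the class `c₁` is
direct, `X c₀` and `Y c₂` are non-empty, then `|X c₁| |Y c₁| + |X c₁| + |Y c₁| ≤ |G| + 1`. -/
theorem ladder_middle_card_add_le {G : Type*} [AddCommGroup G] [DecidableEq G] [Fintype G] {r : ℕ}
    (X Y : Fin r → Finset G)
    (hL : ∀ c p q : Fin r, p < q → ∀ x ∈ X c, ∀ y ∈ Y c, ∀ x' ∈ X p, ∀ y' ∈ Y q, y - x ≠ y' - x')
    (c₀ c₁ c₂ : Fin r) (h₀₁ : c₀ < c₁) (h₁₂ : c₁ < c₂)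
    (hW₁ : ∀ x ∈ X c₁, ∀ x' ∈ X c₁, ∀ y ∈ Y c₁, ∀ y' ∈ Y c₁,
      (x - x') + (y - y') = 0 → x = x' ∧ y = y')
    (h₀ : (X c₀).Nonempty) (h₂ : (Y c₂).Nonempty) :
    (X c₁).card * (Y c₁).card + (X c₁).card + (Y c₁).card ≤ Fintype.card G + 1 := by
  obtain ⟨p₀, hp₀⟩ := h₀
  obtain ⟨q₂, hq₂⟩ := h₂
  set A : Finset G := (Y c₁).image (· - p₀) with hA
  set B : Finset G := (X c₁).image (q₂ - ·) with hB
  set E : Finset G := Y c₁ - X c₁ with hE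
  have hAc : A.card = (Y c₁).card := by
    rw [hA]; exact card_image_of_injective _ (sub_left_injective)
  have hBc : B.card = (X c₁).card := by
    rw [hB]; exact card_image_of_injective _ (sub_right_injective)
  have hEc : E.card = (Y c₁).card * (X c₁).card := card_sub_eq_card_mul_card_of_direct _ _ hW₁
  -- the two cross sets avoid the diagonal set
  have hdisj : Disjoint (A ∪ B) E := by
    rw [Finset.disjoint_left]
    intro g hg hgE
    rw [hE, mem_sub] at hgE
    obtain ⟨y, hy, x, hx, rfl⟩ := hgE
    rw [mem_union] at hg
    rcases hg with hg | hg
    · rw [hA, mem_image] at hg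
      obtain ⟨y', hy', he⟩ := hg
      exact hL c₁ c₀ c₁ h₀₁ x hx y hy p₀ hp₀ y' hy' he.symm
    · rw [hB, mem_image] at hg
      obtain ⟨x', hx', he⟩ := hg
      exact hL c₁ c₁ c₂ h₁₂ x hx y hy x' hx' q₂ hq₂ he.symm
  -- and meet in at most one point
  have hinter : (A ∩ B).card ≤ 1 := by
    refine Finset.card_le_one.2 fun g hg g' hg' => ?_
    rw [mem_inter, hA, hB, mem_image, mem_image] at hg hg'
    obtain ⟨⟨y, hy, rfl⟩, ⟨x, hx, hxy⟩⟩ := hg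
    obtain ⟨⟨y', hy', hgg⟩, ⟨x', hx', hxy'⟩⟩ := hg'
    -- q₂ - x = y - p₀ and q₂ - x' = y' - p₀
    have e1 : q₂ - x = y - p₀ := hxy
    have e2 : q₂ - x' = y' - p₀ := hxy'.trans hgg.symm
    have h0 : (x - x') + (y - y') = 0 :=
      calc (x - x') + (y - y') = ((q₂ - x') - (q₂ - x)) + ((y - p₀) - (y' - p₀)) := by abel
        _ = ((y' - p₀) - (y - p₀)) + ((y - p₀) - (y' - p₀)) := by rw [e1, e2]
        _ = 0 := by abel
    obtain ⟨rfl, rfl⟩ := hW₁ x hx x' hx' y hy y' hy' h0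
    exact hgg
  have h1 : (A ∪ B).card + E.card ≤ Fintype.card G := by
    rw [← card_union_of_disjoint hdisj]; exact card_le_univ _
  have h2 := Finset.card_union_add_card_inter A B
  rw [hAc, hBc] at h2
  rw [hEc] at h1
  nlinarith [h1, h2, hinter]

end Summit.MatrixMultiplication.MatrixMultiplication.Theorems.PrimeTwoFamilies.LadderLift
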